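import Summits.Ventures.HodgeRepro2.HodgePeriodHeckeSymmetry
import Summits.Ventures.HodgeRepro2.HeckeFamilyComposition
import Summits.Ventures.HodgeRepro2.DoubleCosetMem

/-!
# HodgePeriodHeckeEigen — the (N)-period pairing against a self-adjoint Hecke eigenform is a Hecke
EIGENFUNCTIONAL: `∫_D ω_{T_δ f} ∧ conj ω_g = r · ∫_D ω_f ∧ conj ω_g` (p2 annex row 162)

Cell pub-hodge-repro2, Tier 5 kernel annex (seat p2, Shimura-data / Hecke side). Proof lane (no new definition).
§8(d): uses an L-value-free non-vanishing device: NO.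

* `inner_heckeFamilyOf_eq_smul_of_eigen` — for `T_δ = T_{δ⁻¹}` on the Petersson space (e.g. `δ⁻¹ ∈ SδS`) and a
  `T_δ`-eigenvector `w` with eigenvalue `μ`: `⟪w, T_δ v⟫ = conj μ · ⟪w, v⟫` for every `v` (the formal adjoint
  pair of row 122 + `T_δ = T_{δ⁻¹}`).
* `setIntegral_hodgeWedge_heckeForms_eigen` — the HODGE-PERIOD form: if `g` is a `T_δ`-eigenform with REAL
  eigenvalue `r` (the situation produced by rows 141 / 151 / 155), then for EVERY weight-3 form `f`
  `∫_D ω_{T_δ f} ∧ conj ω_g = r · ∫_D ω_f ∧ conj ω_g`: the functional `f ↦ ∫_D ω_f ∧ conj ω_g` — the one the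
  (N)-period argument evaluates on the vertex form — is a `T_δ`-eigenfunctional of eigenvalue `r`.
* `setIntegral_hodgeWedge_heckeForms_eigen_of_inv_mem_doubleCoset` — the same under the honest double-coset
  hypothesis `δ⁻¹ ∈ SδS` (row 139).
* `setIntegral_hodgeWedge_heckeForms_eigen_of_mul_self_eq_one` — the same for an involution `δ² = 1` (the
  `δ` of rows 151 / 155 / 161).

No `sorry`; `#print axioms` ⊆ {propext, Classical.choice, Quot.sound}.
-/

namespace Summit.Ventures.HodgeRepro2.ShimuraData

open Summit.Ventures.HodgeRepro2.JointEigenbasis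

variable {K : Type*} [Field K] [NumberField K] [NumberField.IsCMField K]
  {τ₁ : K →+* ℂ} {H : Matrix (Fin 3) (Fin 3) K} {Q : Matrix (Fin 3) (Fin 3) ℂ}
  (hQ : IsFrame K τ₁ H Q) (S : Subgroup (GL (Fin 3) K)) (hS : (S : Set (GL (Fin 3) K)) ⊆ unitaryGroup K H)
  [CompactSpace (ballQuotient hQ S hS)] {D : Set ball₂}

/-- For `T_δ = T_{δ⁻¹}` and a `T_δ`-eigenvector `w` of eigenvalue `μ`: `⟪w, T_δ v⟫ = conj μ · ⟪w, v⟫`. -/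
theorem inner_heckeFamilyOf_eq_smul_of_eigen (k : ℕ) (hD : IsBallFundamentalDomain hQ S hS D)
    (hDm : MeasurableSet D)
    (inst : ∀ δ : unitaryGroup K H, Fintype (S ⧸ (heckeSubgroup S (δ : GL (Fin 3) K)).subgroupOf S))
    {δ : unitaryGroup K H}
    (hself : heckeFamilyOf hQ S hS k hD hDm inst δ = heckeFamilyOf hQ S hS k hD hDm inst δ⁻¹)
    {w : PeterssonSpace hQ S hS k hD} {μ : ℂ} (hw : heckeFamilyOf hQ S hS k hD hDm inst δ w = μ • w)
    (v : PeterssonSpace hQ S hS k hD) :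
    inner ℂ w (heckeFamilyOf hQ S hS k hD hDm inst δ v) = (starRingEnd ℂ) μ * inner ℂ w v := by
  have hadj := isFormalAdjointPair_heckeFamilyOf hQ S hS k hD hDm inst δ⁻¹
  rw [inv_inv, ← hself] at hadj
  -- `hadj : ⟪T_δ x, y⟫ = ⟪x, T_δ y⟫` for all `x y`
  rw [← hadj w v, hw, inner_smul_left]

/-- THE HODGE-PERIOD EIGENFUNCTIONAL. If `g` is a `T_δ`-eigenform with real eigenvalue `r` and
`T_δ = T_{δ⁻¹}` on the Petersson space, then `∫_D ω_{T_δ f} ∧ conj ω_g = r · ∫_D ω_f ∧ conj ω_g` for every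
weight-3 form `f`. -/
theorem setIntegral_hodgeWedge_heckeForms_eigen (hD : IsBallFundamentalDomain hQ S hS D)
    (hDm : MeasurableSet D)
    (inst : ∀ δ : unitaryGroup K H, Fintype (S ⧸ (heckeSubgroup S (δ : GL (Fin 3) K)).subgroupOf S))
    {δ : unitaryGroup K H}
    (hself : heckeFamilyOf hQ S hS 3 hD hDm inst δ = heckeFamilyOf hQ S hS 3 hD hDm inst δ⁻¹)
    {g : PeterssonForms hQ S hS 3 hD} {r : ℝ}
    (hg : heckeFamilyOf hQ S hS 3 hD hDm inst δ (SeparationQuotient.mk g) = (r : ℂ) • SeparationQuotient.mk g)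
    (f : PeterssonForms hQ S hS 3 hD) :
    ∫ x in (Subtype.val '' D),
        hodgeWedge (PeterssonForms.toForm hQ S hS 3 hD
          (@heckeForms _ _ _ _ _ _ _ hQ S hS _ _ 3 hD _ δ.2 (inst δ) f) : (Fin 2 → ℂ) → ℂ)
          (PeterssonForms.toForm hQ S hS 3 hD g : (Fin 2 → ℂ) → ℂ) x =
      (r : ℂ) * ∫ x in (Subtype.val '' D),
        hodgeWedge (PeterssonForms.toForm hQ S hS 3 hD f : (Fin 2 → ℂ) → ℂ)
          (PeterssonForms.toForm hQ S hS 3 hD g : (Fin 2 → ℂ) → ℂ) x := by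
  rw [setIntegral_hodgeWedge_eq_inner_mk hQ S hS hD hDm, setIntegral_hodgeWedge_eq_inner_mk hQ S hS hD hDm,
    ← heckeFamilyOf_mk hQ S hS 3 hD hDm inst δ f,
    inner_heckeFamilyOf_eq_smul_of_eigen hQ S hS 3 hD hDm inst hself hg, Complex.conj_ofReal]
  ring

/-- The eigenfunctional statement under the honest double-coset hypothesis `δ⁻¹ ∈ SδS` (row 139). -/
theorem setIntegral_hodgeWedge_heckeForms_eigen_of_inv_mem_doubleCoset (hD : IsBallFundamentalDomain hQ S hS D)
    (hDm : MeasurableSet D)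
    (inst : ∀ δ : unitaryGroup K H, Fintype (S ⧸ (heckeSubgroup S (δ : GL (Fin 3) K)).subgroupOf S))
    {δ : unitaryGroup K H} (hδ : (δ : GL (Fin 3) K)⁻¹ ∈ doubleCoset S δ)
    {g : PeterssonForms hQ S hS 3 hD} {r : ℝ}
    (hg : heckeFamilyOf hQ S hS 3 hD hDm inst δ (SeparationQuotient.mk g) = (r : ℂ) • SeparationQuotient.mk g)
    (f : PeterssonForms hQ S hS 3 hD) :
    ∫ x in (Subtype.val '' D),
        hodgeWedge (PeterssonForms.toForm hQ S hS 3 hD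
          (@heckeForms _ _ _ _ _ _ _ hQ S hS _ _ 3 hD _ δ.2 (inst δ) f) : (Fin 2 → ℂ) → ℂ)
          (PeterssonForms.toForm hQ S hS 3 hD g : (Fin 2 → ℂ) → ℂ) x =
      (r : ℂ) * ∫ x in (Subtype.val '' D),
        hodgeWedge (PeterssonForms.toForm hQ S hS 3 hD f : (Fin 2 → ℂ) → ℂ)
          (PeterssonForms.toForm hQ S hS 3 hD g : (Fin 2 → ℂ) → ℂ) x :=
  setIntegral_hodgeWedge_heckeForms_eigen hQ S hS hD hDm inst
    (heckeFamilyOf_eq_inv_of_inv_mem_doubleCoset hQ S hS 3 hD hDm inst hδ) hg f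

/-- The eigenfunctional statement for an involution `δ² = 1` (the `δ` of rows 151 / 155 / 161). -/
theorem setIntegral_hodgeWedge_heckeForms_eigen_of_mul_self_eq_one (hD : IsBallFundamentalDomain hQ S hS D)
    (hDm : MeasurableSet D)
    (inst : ∀ δ : unitaryGroup K H, Fintype (S ⧸ (heckeSubgroup S (δ : GL (Fin 3) K)).subgroupOf S))
    {δ : unitaryGroup K H} (hδ : (δ : GL (Fin 3) K) * δ = 1)
    {g : PeterssonForms hQ S hS 3 hD} {r : ℝ}
    (hg : heckeFamilyOf hQ S hS 3 hD hDm inst δ (SeparationQuotient.mk g) = (r : ℂ) • SeparationQuotient.mk g)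
    (f : PeterssonForms hQ S hS 3 hD) :
    ∫ x in (Subtype.val '' D),
        hodgeWedge (PeterssonForms.toForm hQ S hS 3 hD
          (@heckeForms _ _ _ _ _ _ _ hQ S hS _ _ 3 hD _ δ.2 (inst δ) f) : (Fin 2 → ℂ) → ℂ)
          (PeterssonForms.toForm hQ S hS 3 hD g : (Fin 2 → ℂ) → ℂ) x =
      (r : ℂ) * ∫ x in (Subtype.val '' D),
        hodgeWedge (PeterssonForms.toForm hQ S hS 3 hD f : (Fin 2 → ℂ) → ℂ)
          (PeterssonForms.toForm hQ S hS 3 hD g : (Fin 2 → ℂ) → ℂ) x :=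
  setIntegral_hodgeWedge_heckeForms_eigen_of_inv_mem_doubleCoset hQ S hS hD hDm inst
    (inv_mem_doubleCoset_of_sq_mem (by rw [hδ]; exact S.one_mem)) hg f

end Summit.Ventures.HodgeRepro2.ShimuraData
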